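import Summits.HodgeConjecture.CorCM.Census.OcticDecicWeilParts
import Summits.HodgeConjecture.CorCM.SexticDecicWeilFrameTransfer
import Summits.HodgeConjecture.CorCM.OcticWeilMultiFrameTransfer
import Summits.HodgeConjecture.CorCM.SexticOcticWeilFrameTransfer
import Summits.HodgeConjecture.CorCM.DecicWeil23PairOneTypeAnyFieldHodgeOfMarkman
import HarnessLib

/-!
# COR-CM — `E × B₄ × B₅` over an OCTIC and a DECIC CM field sharing `k`: the model map, the REALISED PAIRS of permutations, the
# REALISED ROTATION of the five decic pairs (Cauchy) and TRANSITIVITY on the four octic pairs (both with NO Galois hypothesis),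
# FRAME TRANSFER, and the divisor lines of conjugate pairs

Cell `pub-hodgecm2` (COR-CM), seat b30 gen 27 (2026-08-23); count-neutral own lane OCTIC-DECIC, over the kernel census
`Census/OcticDecicWeil{,Defect,Parts,PartsBalanced,Extraction}`; the degree-`(8,10)` twin of `CorCM/SexticDecicWeilFrameTransfer` (whose
`dihPerm_zero_one_eq_finRotate` is used BY NAME; the slots `soSlots i₀ i₁ i₂` and the size-free frame lemmas are gen 26ʼs, BY NAME).  Theorems,
plus TWO bookkeeping definitions (the model map `toPtOD`, the finset `realisedPairs₄₅` of pairs of permutations of the conjugate pairs of `K₂`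
and of `K₃` induced by ONE automorphism of `ℂ`); no named fact, no `sorry`.
SETTING: index type `I`, fields `Kf`, three slots `soSlots i₀ i₁ i₂` (here: `k`, the OCTIC field, the DECIC field); realisations
`A j ⊨ (Kf (soSlots i₀ i₁ i₂ j); Φ j)`: `E = A 0 ⊨ (k; {τ})` (`hΨ`), `B₄ = A 1 ⊨ (K₂; Φ 1)` with `s ∈ Φ 1 ⟺ (e₂ s).2 = [(e₂ s).1 = 0]`
(`hΦ₂`) for a frame `e₂ : Hom(K₂,ℂ) ≃ Fin 4 × Bool`, `B₅ = A 2 ⊨ (K₃; Φ 2)` with `t ∈ Φ 2 ⟺ (e₃ t).2 = [(e₃ t).1 ∈ {0,1}]` (`hΦ₃`) for a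
frame `e₃ : Hom(K₃,ℂ) ≃ Fin 5 × Bool`.

* §0 `toPtOD`; §1 `realisedPairs₄₅ e₂ e₃`, `mul_mem_realisedPairs₄₅`, `pow_mem_realisedPairs₄₅`; **`exists_mem_realisedPairs₄₅_apply_eq_zero`**
  (every octic pair is moved to `0`: `ZarhinLie.exists_ringEquiv_complex_comp_eq`); **`exists_conj_rot_mem_realisedPairs₄₅`** (`(1, g(+1)g⁻¹)`
  is realised: gen 23ʼs `DecicWeil23Pair.exists_orderFive_mem_realisedPerms` + `exists_conj_rot_of_orderFive` BY NAME, then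
  `(π₂, σ)³⁶ = (1, σ)`), **`rot_stable_realisedPairs₄₅`**;
* §2 `toPtOD_injective`, `toPtOD_conj_smul`, `comp_mem_iff_toPtOD_mem_phiOD`, **`modelBalancedOD_of_isGaloisBalancedAlg`** — FRAME
  TRANSFER for every slot map `κ : Fin N → Fin 3`, NO Galois hypothesis; §3 `weightClassesAlg_le_algebraicClasses_of_isPairPartOD`.
HONEST FRAMING: nothing about the Hodge conjecture is concluded here; `HC_CM` is not asserted.
[cite: Pohlmann1968, Thm 1] [cite: GaoUllmo2025, Thm 3.1 (3.2)] [cite: Shimura1998, §18.2 Lemma (i)] [cite: DixonMortimer1996, §2.1]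
[cite: Gordon1999HodgeAVSurvey, 9.2.2]

## References
* [Pohlmann1968] Ann. of Math. 88 (1968), Thm 1.  [GaoUllmo2025] J. Inst. Math. Jussieu 25 (2025), Thm 3.1 (3.2).  [Shimura1998]
  G. Shimura, *Abelian varieties with CM and modular functions*, §18.2 Lemma (i).  [DixonMortimer1996] J. D. Dixon, B. Mortimer,
  *Permutation Groups*, GTM 163 (1996), §2.1 (orbit–stabiliser; Cauchy).  [Gordon1999HodgeAVSurvey] CRM Monogr. 10 (1999), 9.2.2.
-/

noncomputable section

open CategoryTheory CategoryTheory.Limits NumberField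

namespace Summit.HodgeConjecture.CorCM.OcticDecicWeil

open Literature.AlgebraicGeometry Literature.AlgebraicGeometry.Motives Literature.AlgebraicGeometry.HodgeTheory
open Literature.AlgebraicGeometry.ComplexMultiplication (IsCMTypeRealisation)
open Literature.AlgebraicGeometry.Pohlmann1968
open Literature.AlgebraicTopology.SingularHomology
open Literature.NumberTheory.ComplexMultiplication
open Summit.HodgeConjecture.CorCM.Census.OcticDecicWeil (PtOD cjOD cjOD_inl cjOD_inr_inl cjOD_inr_inr cjOD_cjOD cjOD_ne phiOD inl_mem_phiOD
  inr_inl_mem_phiOD inr_inr_mem_phiOD ModelBalancedOD IsPairPartOD)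
open Summit.HodgeConjecture.CorCM.SexticDecicWeil (dihPerm_zero_one_eq_finRotate)
open Summit.HodgeConjecture.CorCM.OcticWeilMulti (comp_eq_tau_iff_of_realisesO)
open Summit.HodgeConjecture.CorCM.SexticOcticWeil (soSlots sigma_cases₃ conj_smul_zero₃ conj_smul_one₃ conj_smul_two₃
  exists_perm_of_comp_tau_eq_fin apply_comp_eq_of_realises_fin comp_tau_eq_of_realises_fin)
open Summit.HodgeConjecture.CorCM.DecicWeil23Pair (realisedPerms mem_realisedPerms exists_orderFive_mem_realisedPerms
  exists_conj_rot_of_orderFive dihPerm_zero_one_apply)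
open Summit.HodgeConjecture.CorCM.Census.DecicWeil23Pair (dihPerm)
open Summit.HodgeConjecture.CorCM.OcticCurveFourfold (comp_injective comp_conjugate)
open Summit.HodgeConjecture.CorCM.CMWeights (weightClassesAlg_comp_le_algebraicClasses_of_injOn)
open Summit.HodgeConjecture.CorCM.PairWeights
open Summit.HodgeConjecture.CorCM.DihedralSexticPairCurvePowers (ncard_sep_eq_card_filter)

open scoped Classical Pointwise

/-! ## §0 The model map -/
section Defs

variable {I : Type} {Kf : I → Type} [∀ i, Field (Kf i)] {i₀ i₁ i₂ : I}

/-- **The model map** `Hom(k × K₂ × K₃, ℂ) → PtOD`: `(0, σ) ↦ inl [σ = τ]`, `(1, s) ↦ inr (inl (e₂ s))`, `(2, t) ↦ inr (inr (e₃ t))`.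
[folklore] -/
def toPtOD (e₂ : (Kf i₁ →+* ℂ) ≃ Fin 4 × Bool) (e₃ : (Kf i₂ →+* ℂ) ≃ Fin 5 × Bool) (τ : Kf i₀ →+* ℂ) :
    ((j : Fin 3) × (Kf (soSlots i₀ i₁ i₂ j) →+* ℂ)) → PtOD := fun x =>
  Fin.cases (motive := fun j => (Kf (soSlots i₀ i₁ i₂ j) →+* ℂ) → PtOD)
    (fun σ => Sum.inl (decide (σ = τ)))
    (fun j' => Fin.cases (motive := fun j' : Fin 2 => (Kf (soSlots i₀ i₁ i₂ j'.succ) →+* ℂ) → PtOD)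
      (fun s => Sum.inr (Sum.inl (e₂ s))) (fun _ t => Sum.inr (Sum.inr (e₃ t))) j') x.1 x.2

variable (e₂ : (Kf i₁ →+* ℂ) ≃ Fin 4 × Bool) (e₃ : (Kf i₂ →+* ℂ) ≃ Fin 5 × Bool) (τ : Kf i₀ →+* ℂ)

/-- `toPtOD` on the curve slot. [folklore] -/
@[simp] theorem toPtOD_zero (σ : Kf i₀ →+* ℂ) : toPtOD e₂ e₃ τ ⟨0, σ⟩ = Sum.inl (decide (σ = τ)) := rfl
/-- `toPtOD` on the fourfold slot. [folklore] -/
@[simp] theorem toPtOD_one (s : Kf i₁ →+* ℂ) : toPtOD e₂ e₃ τ ⟨1, s⟩ = Sum.inr (Sum.inl (e₂ s)) := rfl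
/-- `toPtOD` on the fivefold slot. [folklore] -/
@[simp] theorem toPtOD_two (t : Kf i₂ →+* ℂ) : toPtOD e₂ e₃ τ ⟨2, t⟩ = Sum.inr (Sum.inr (e₃ t)) := rfl

end Defs

/-! ## §1 The realised pairs of permutations; the realised rotation; transitivity on the octic pairs -/

section Realised

variable {F₂ F₃ k : Type} [Field F₂] [Field F₃] [Field k]

/-- **The realised pairs**: the pairs `(π₂, π₃)` of permutations of the four conjugate pairs of `K₂` and the five of `K₃` induced by
ONE automorphism `ρ` of `ℂ` (`ρ ∘ e₂⁻¹(a, true) = e₂⁻¹(π₁ a, true)` and `ρ ∘ e₃⁻¹(b, true) = e₃⁻¹(π₃ b, true)`).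
[cite: Shimura1998, §18.2 Lemma (i)] -/
def realisedPairs₄₅ (e₂ : (F₂ →+* ℂ) ≃ Fin 4 × Bool) (e₃ : (F₃ →+* ℂ) ≃ Fin 5 × Bool) :
    Finset (Equiv.Perm (Fin 4) × Equiv.Perm (Fin 5)) :=
  Finset.univ.filter fun π => ∃ ρ : ℂ ≃+* ℂ,
    (∀ a : Fin 4, (ρ : ℂ →+* ℂ).comp (e₂.symm (a, true)) = e₂.symm (π.1 a, true)) ∧
      ∀ b : Fin 5, (ρ : ℂ →+* ℂ).comp (e₃.symm (b, true)) = e₃.symm (π.2 b, true)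

variable (e₂ : (F₂ →+* ℂ) ≃ Fin 4 × Bool) (e₃ : (F₃ →+* ℂ) ≃ Fin 5 × Bool)

/-- Membership in `realisedPairs₄₅ e₂ e₃`. [folklore] -/
theorem mem_realisedPairs₄₅ (π : Equiv.Perm (Fin 4) × Equiv.Perm (Fin 5)) :
    π ∈ realisedPairs₄₅ e₂ e₃ ↔ ∃ ρ : ℂ ≃+* ℂ,
      (∀ a : Fin 4, (ρ : ℂ →+* ℂ).comp (e₂.symm (a, true)) = e₂.symm (π.1 a, true)) ∧
        ∀ b : Fin 5, (ρ : ℂ →+* ℂ).comp (e₃.symm (b, true)) = e₃.symm (π.2 b, true) := by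
  simp [realisedPairs₄₅]

/-- **Closed under composition** (compose the automorphisms). [folklore] -/
theorem mul_mem_realisedPairs₄₅ {π π' : Equiv.Perm (Fin 4) × Equiv.Perm (Fin 5)} (h : π ∈ realisedPairs₄₅ e₂ e₃)
    (h' : π' ∈ realisedPairs₄₅ e₂ e₃) : π * π' ∈ realisedPairs₄₅ e₂ e₃ := by
  obtain ⟨ρ, h₁, h₃⟩ := (mem_realisedPairs₄₅ e₂ e₃ π).1 h
  obtain ⟨ρ', h₁', h₃'⟩ := (mem_realisedPairs₄₅ e₂ e₃ π').1 h'
  refine (mem_realisedPairs₄₅ e₂ e₃ _).2 ⟨ρ'.trans ρ, fun a => ?_, fun b => ?_⟩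
  · rw [RingEquiv.coe_ringHom_trans, RingHom.comp_assoc, h₁' a, h₁ (π'.1 a), Prod.fst_mul, Equiv.Perm.mul_apply]
  · rw [RingEquiv.coe_ringHom_trans, RingHom.comp_assoc, h₃' b, h₃ (π'.2 b), Prod.snd_mul, Equiv.Perm.mul_apply]

/-- **Closed under powers.** [folklore] -/
theorem pow_mem_realisedPairs₄₅ {π : Equiv.Perm (Fin 4) × Equiv.Perm (Fin 5)} (h : π ∈ realisedPairs₄₅ e₂ e₃) (n : ℕ) :
    π ^ (n + 1) ∈ realisedPairs₄₅ e₂ e₃ := by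
  induction n with
  | zero => rw [zero_add, pow_one]; exact h
  | succ n ih => rw [pow_succ]; exact mul_mem_realisedPairs₄₅ e₂ e₃ ih h

variable {e₂ e₃} {τ : k →+* ℂ} {i₂ : k →+* F₂} {i₃ : k →+* F₃}
  (he₂_sign : ∀ s : F₂ →+* ℂ, (e₂ s).2 = true ↔ s.comp i₂ = τ)
  (he₃_sign : ∀ t : F₃ →+* ℂ, (e₃ t).2 = true ↔ t.comp i₃ = τ)

include he₂_sign he₃_sign in
/-- **Every octic pair is moved to the pair `0` by a realised pair** (NO Galois hypothesis): an automorphism of `ℂ` carrying the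
embedding `e₂⁻¹(x, +)` of the countable field `K₂` to `e₂⁻¹(0, +)` exists (`ZarhinLie.exists_ringEquiv_complex_comp_eq`); it fixes
`τ`, hence permutes both `τ`-fibres. [cite: Shimura1998, §18.2 Lemma (i)] -/
theorem exists_mem_realisedPairs₄₅_apply_eq_zero [NumberField F₂] (x : Fin 4) : ∃ π ∈ realisedPairs₄₅ e₂ e₃, π.1 x = 0 := by
  haveI : Countable F₂ := Countable.of_equiv _ (Module.finBasis ℚ F₂).equivFun.toEquiv.symm
  obtain ⟨ρ, hρ⟩ := ZarhinLie.exists_ringEquiv_complex_comp_eq (e₂.symm (x, true)) (e₂.symm (0, true))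
  have hx : (ρ : ℂ →+* ℂ).comp (e₂.symm (x, true)) = e₂.symm (0, true) := RingHom.ext fun z => hρ z
  have hρτ : (ρ : ℂ →+* ℂ).comp τ = τ := by
    have hx' : (e₂.symm (x, true)).comp i₂ = τ := (he₂_sign _).1 (by rw [Equiv.apply_symm_apply])
    have h0 : (e₂.symm ((0 : Fin 4), true)).comp i₂ = τ := (he₂_sign _).1 (by rw [Equiv.apply_symm_apply])
    calc (ρ : ℂ →+* ℂ).comp τ = ((ρ : ℂ →+* ℂ).comp (e₂.symm (x, true))).comp i₂ := by rw [RingHom.comp_assoc, hx']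
      _ = τ := by rw [hx, h0]
  obtain ⟨π₁, hπ₁⟩ := exists_perm_of_comp_tau_eq_fin he₂_sign ρ hρτ
  obtain ⟨π₃, hπ₃⟩ := exists_perm_of_comp_tau_eq_fin he₃_sign ρ hρτ
  refine ⟨(π₁, π₃), (mem_realisedPairs₄₅ e₂ e₃ _).2 ⟨ρ, hπ₁, hπ₃⟩, ?_⟩
  exact (Prod.mk.inj (e₂.symm.injective ((hπ₁ x).symm.trans hx))).1

/-- Every permutation of four letters has order dividing `12`, hence `π³⁶ = 1`. [folklore] -/
theorem perm_fin_four_pow_thirtySix (π : Equiv.Perm (Fin 4)) : π ^ 36 = 1 := by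
  have h12 : ∀ π : Equiv.Perm (Fin 4), π ^ 12 = 1 := by decide +kernel
  rw [show 36 = 12 * 3 from rfl, pow_mul, h12, one_pow]

include he₂_sign he₃_sign in
/-- **A conjugate rotation of the five decic pairs is realised, paired with the identity on the octic pairs** (NO Galois hypothesis).
The realised permutations of the five pairs form a transitive group, whose order is divisible by `5`, so it has an element `σ` of order
`5` (Cauchy; gen 23ʼs `DecicWeil23Pair.exists_orderFive_mem_realisedPerms`), a conjugate `g (+1) g⁻¹` of the rotation
(`exists_conj_rot_of_orderFive`); a realiser of `σ` fixes `τ` and so realises a pair `(π₂, σ)`, and `(π₂, σ)³⁶ = (1, σ)`.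
[cite: DixonMortimer1996, §2.1] [cite: Shimura1998, §18.2 Lemma (i)] -/
theorem exists_conj_rot_mem_realisedPairs₄₅ [NumberField F₃] :
    ∃ g : Equiv.Perm (Fin 5), ((1 : Equiv.Perm (Fin 4)), g * finRotate 5 * g⁻¹) ∈ realisedPairs₄₅ e₂ e₃ := by
  obtain ⟨σ, hσ, h5, h1⟩ := exists_orderFive_mem_realisedPerms (e := e₃) he₃_sign
  obtain ⟨ρ, hρ₃⟩ := (mem_realisedPerms e₃ σ).1 hσ
  have hρτ : (ρ : ℂ →+* ℂ).comp τ = τ := comp_tau_eq_of_realises_fin he₃_sign ρ hρ₃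
  obtain ⟨π₁, hπ₁⟩ := exists_perm_of_comp_tau_eq_fin he₂_sign ρ hρτ
  have hmem : (π₁, σ) ∈ realisedPairs₄₅ e₂ e₃ := (mem_realisedPairs₄₅ e₂ e₃ _).2 ⟨ρ, hπ₁, hρ₃⟩
  have h36 : (π₁, σ) ^ (35 + 1) = (1, σ) := by
    rw [Prod.pow_mk, perm_fin_four_pow_thirtySix π₁, pow_succ, show σ ^ 35 = 1 by rw [show 35 = 5 * 7 from rfl, pow_mul, h5, one_pow],
      one_mul]
  obtain ⟨g, hg⟩ := exists_conj_rot_of_orderFive σ h5 h1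
  refine ⟨g, ?_⟩
  rw [← dihPerm_zero_one_eq_finRotate, hg, ← h36]
  exact pow_mem_realisedPairs₄₅ e₂ e₃ hmem 35

include he₂_sign he₃_sign in
/-- **The realised pairs are stable under right translation of the decic component by a realised conjugate rotation**
(`π ↦ (π₁, π₃ ∘ g(+1)g⁻¹)`): the hypothesis `hrot` of the census. [cite: DixonMortimer1996, §2.1] -/
theorem rot_stable_realisedPairs₄₅ [NumberField F₃] :
    ∃ g : Equiv.Perm (Fin 5), ∀ π ∈ realisedPairs₄₅ e₂ e₃, (π.1, π.2 * (g * finRotate 5 * g⁻¹)) ∈ realisedPairs₄₅ e₂ e₃ := by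
  obtain ⟨g, hg⟩ := exists_conj_rot_mem_realisedPairs₄₅ he₂_sign he₃_sign
  refine ⟨g, fun π hπ => ?_⟩
  have h := mul_mem_realisedPairs₄₅ e₂ e₃ hπ hg
  rwa [Prod.mk_mul_mk, mul_one] at h

end Realised

/-! ## §2 Frame transfer for the products of copies, no Galois hypothesis -/

section Transfer

variable {I : Type} {Kf : I → Type} [∀ i, Field (Kf i)] {i₀ i₁ i₂ : I}
  {e₂ : (Kf i₁ →+* ℂ) ≃ Fin 4 × Bool} {e₃ : (Kf i₂ →+* ℂ) ≃ Fin 5 × Bool} {τ : Kf i₀ →+* ℂ}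
  (hττ : ComplexEmbedding.conjugate τ ≠ τ) (hk : ∀ σ : Kf i₀ →+* ℂ, σ = τ ∨ σ = ComplexEmbedding.conjugate τ)

include hττ hk in
/-- The model map is injective (`Hom(k, ℂ) = {τ, τ̄}`, `e₂`, `e₃` bijections, the slot is recorded). [folklore] -/
theorem toPtOD_injective : Function.Injective (toPtOD (i₀ := i₀) e₂ e₃ τ) := by
  intro x y hxy
  rcases sigma_cases₃ x with ⟨σ, rfl⟩ | ⟨s, rfl⟩ | ⟨t, rfl⟩ <;>
    rcases sigma_cases₃ y with ⟨σ', rfl⟩ | ⟨s', rfl⟩ | ⟨t', rfl⟩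
  · rw [toPtOD_zero, toPtOD_zero, Sum.inl.injEq] at hxy
    rcases hk σ with rfl | rfl <;> rcases hk σ' with rfl | rfl
    · rfl
    · simp only [decide_true] at hxy; exact absurd (of_decide_eq_true hxy.symm) hττ
    · simp only [decide_true] at hxy; exact absurd (of_decide_eq_true hxy) hττ
    · rfl
  · exact absurd hxy (by rw [toPtOD_zero, toPtOD_one]; exact Sum.inl_ne_inr)
  · exact absurd hxy (by rw [toPtOD_zero, toPtOD_two]; exact Sum.inl_ne_inr)
  · exact absurd hxy (by rw [toPtOD_zero, toPtOD_one]; exact Sum.inr_ne_inl)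
  · rw [toPtOD_one, toPtOD_one, Sum.inr.injEq, Sum.inl.injEq] at hxy
    rw [e₂.injective hxy]
  · exact absurd hxy (by rw [toPtOD_one, toPtOD_two, Sum.inr.injEq]; exact Sum.inl_ne_inr)
  · exact absurd hxy (by rw [toPtOD_zero, toPtOD_two]; exact Sum.inr_ne_inl)
  · exact absurd hxy (by rw [toPtOD_one, toPtOD_two, Sum.inr.injEq]; exact Sum.inr_ne_inl)
  · rw [toPtOD_two, toPtOD_two, Sum.inr.injEq, Sum.inr.injEq] at hxy
    rw [e₃.injective hxy]

variable {i₂' : Kf i₀ →+* Kf i₁} {i₃' : Kf i₀ →+* Kf i₂}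
  (he₂_sign : ∀ s : Kf i₁ →+* ℂ, (e₂ s).2 = true ↔ s.comp i₂' = τ)
  (he₃_sign : ∀ t : Kf i₂ →+* ℂ, (e₃ t).2 = true ↔ t.comp i₃' = τ)
  (he₂_conj : ∀ s : Kf i₁ →+* ℂ, e₂ (ComplexEmbedding.conjugate s) = ((e₂ s).1, !(e₂ s).2))
  (he₃_conj : ∀ t : Kf i₂ →+* ℂ, e₃ (ComplexEmbedding.conjugate t) = ((e₃ t).1, !(e₃ t).2))

include he₂_conj he₃_conj hττ hk in
/-- Conjugation is read in the model: `toPtOD x̄ = cjOD (toPtOD x)`. [folklore] -/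
theorem toPtOD_conj_smul (x : (j : Fin 3) × (Kf (soSlots i₀ i₁ i₂ j) →+* ℂ)) :
    toPtOD e₂ e₃ τ ((starRingAut : ℂ ≃+* ℂ) • x) = cjOD (toPtOD e₂ e₃ τ x) := by
  rcases sigma_cases₃ x with ⟨σ, rfl⟩ | ⟨s, rfl⟩ | ⟨t, rfl⟩
  · have key : decide (ComplexEmbedding.conjugate σ = τ) = !decide (σ = τ) := by
      rcases hk σ with rfl | rfl
      · rw [decide_eq_false hττ]; simp
      · rw [ComplexEmbedding.involutive_conjugate, decide_eq_false hττ]; simp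
    rw [conj_smul_zero₃, toPtOD_zero, toPtOD_zero, key, cjOD_inl]
  · rw [conj_smul_one₃, toPtOD_one, toPtOD_one, he₂_conj, cjOD_inr_inl]
  · rw [conj_smul_two₃, toPtOD_two, toPtOD_two, he₃_conj, cjOD_inr_inr]

variable {Φ : ∀ j : Fin 3, CMType (Kf (soSlots i₀ i₁ i₂ j))}
  (hΨ : ∀ σ : Kf i₀ →+* ℂ, σ ∈ (Φ 0).1 ↔ σ = τ)
  (hΦ₂ : ∀ s : Kf i₁ →+* ℂ, s ∈ (Φ 1).1 ↔ (e₂ s).2 = decide ((e₂ s).1 = 0))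
  (hΦ₃ : ∀ t : Kf i₂ →+* ℂ, t ∈ (Φ 2).1 ↔ (e₃ t).2 = decide ((e₃ t).1 = 0 ∨ (e₃ t).1 = 1))

include hττ hk he₂_sign he₂_conj he₃_conj hΨ hΦ₂ hΦ₃ in
/-- **Membership read in the frames**: for a realiser `ρ` of the pair `π`, `ρ ∘ x ∈ Φ ⟺ toPtOD x ∈ phiOD π` (on the curve slot `ρ`
fixes `τ`; on the other slots `ρ` keeps signs and moves the pair `a` to `π.1 a`, resp. `π.2 a`).
[cite: GaoUllmo2025, Thm 3.1 (3.2)] [cite: Shimura1998, §18.2 Lemma (i)] -/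
theorem comp_mem_iff_toPtOD_mem_phiOD [NumberField (Kf i₁)] [IsCMField (Kf i₁)] [NumberField (Kf i₂)] [IsCMField (Kf i₂)]
    {ρ : ℂ ≃+* ℂ} {π : Equiv.Perm (Fin 4) × Equiv.Perm (Fin 5)}
    (hρ₂ : ∀ a : Fin 4, (ρ : ℂ →+* ℂ).comp (e₂.symm (a, true)) = e₂.symm (π.1 a, true))
    (hρ₃ : ∀ b : Fin 5, (ρ : ℂ →+* ℂ).comp (e₃.symm (b, true)) = e₃.symm (π.2 b, true))
    (x : (j : Fin 3) × (Kf (soSlots i₀ i₁ i₂ j) →+* ℂ)) :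
    (ρ : ℂ →+* ℂ).comp x.2 ∈ (Φ x.1).1 ↔ toPtOD e₂ e₃ τ x ∈ phiOD π := by
  rcases sigma_cases₃ x with ⟨σ, rfl⟩ | ⟨s, rfl⟩ | ⟨t, rfl⟩
  · change (ρ : ℂ →+* ℂ).comp σ ∈ (Φ 0).1 ↔ _
    rw [hΨ, toPtOD_zero, inl_mem_phiOD, comp_eq_tau_iff_of_realisesO hττ hk he₂_sign ρ hρ₂ σ]
    exact ⟨fun h => decide_eq_true h, fun h => of_decide_eq_true h⟩
  · change (ρ : ℂ →+* ℂ).comp s ∈ (Φ 1).1 ↔ _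
    rw [hΦ₂, toPtOD_one, apply_comp_eq_of_realises_fin he₂_conj ρ hρ₂ s, inr_inl_mem_phiOD]
  · change (ρ : ℂ →+* ℂ).comp t ∈ (Φ 2).1 ↔ _
    rw [hΦ₃, toPtOD_two, apply_comp_eq_of_realises_fin he₃_conj ρ hρ₃ t, inr_inr_mem_phiOD]

variable {N : ℕ} (κ : Fin N → Fin 3)

include hττ hk he₂_sign he₂_conj he₃_conj hΨ hΦ₂ hΦ₃ in
/-- **FRAME TRANSFER, no Galois hypothesis**: an `Aut(ℂ)`-balanced weight of `X = ⨁_j A(κ j)` (`IsGaloisBalancedAlg` for the CM algebra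
`∏_j K_{κ j}`, types `Φ (κ j)`) is a balanced configuration of the census model under EVERY realised pair of permutations
(`R = realisedPairs₄₅ e₂ e₃`), via `v = toPtOD e₂ e₃ τ ∘ P`, `P (j, s) = (κ j, s)`. [cite: GaoUllmo2025, Thm 3.1 (3.2)] [cite: Pohlmann1968, Thm 1] -/
theorem modelBalancedOD_of_isGaloisBalancedAlg [NumberField (Kf i₁)] [IsCMField (Kf i₁)] [NumberField (Kf i₂)] [IsCMField (Kf i₂)]
    {S : Finset ((j : Fin N) × (Kf (soSlots i₀ i₁ i₂ (κ j)) →+* ℂ))}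
    (hS : IsGaloisBalancedAlg (K := fun j => Kf (soSlots i₀ i₁ i₂ (κ j))) (fun j => Φ (κ j)) S) :
    ModelBalancedOD (realisedPairs₄₅ e₂ e₃) (fun x => toPtOD e₂ e₃ τ ((Sigma.map κ (fun _ => id) :
      ((j : Fin N) × (Kf (soSlots i₀ i₁ i₂ (κ j)) →+* ℂ)) → ((m : Fin 3) × (Kf (soSlots i₀ i₁ i₂ m) →+* ℂ))) x)) S := by
  intro π hπ
  beta_reduce
  obtain ⟨ρ, hρ₂, hρ₃⟩ := (mem_realisedPairs₄₅ e₂ e₃ π).1 hπ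
  have h := hS ρ
  rw [ncard_sep_eq_card_filter, ncard_sep_eq_card_filter] at h
  have key : ∀ x : (j : Fin N) × (Kf (soSlots i₀ i₁ i₂ (κ j)) →+* ℂ),
      (ρ : ℂ →+* ℂ).comp x.2 ∈ (Φ (κ x.1)).1 ↔ toPtOD e₂ e₃ τ ((Sigma.map κ (fun _ => id) :
        ((j : Fin N) × (Kf (soSlots i₀ i₁ i₂ (κ j)) →+* ℂ)) → ((m : Fin 3) × (Kf (soSlots i₀ i₁ i₂ m) →+* ℂ))) x) ∈ phiOD π :=
    fun x => comp_mem_iff_toPtOD_mem_phiOD hττ hk he₂_sign he₂_conj he₃_conj hΨ hΦ₂ hΦ₃ hρ₂ hρ₃ ⟨κ x.1, x.2⟩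
  rw [Finset.filter_congr fun x _ => key x, Finset.filter_congr fun x _ => (key x).not] at h
  have htot := Finset.card_filter_add_card_filter_not
    (s := S) (fun x => toPtOD e₂ e₃ τ ((Sigma.map κ (fun _ => id) :
        ((j : Fin N) × (Kf (soSlots i₀ i₁ i₂ (κ j)) →+* ℂ)) → ((m : Fin 3) × (Kf (soSlots i₀ i₁ i₂ m) →+* ℂ))) x) ∈ phiOD π)
  omega

end Transfer

/-! ## §3 Conjugate pairs have algebraic (divisor) lines -/

section Pairs

variable {I : Type} {Kf : I → Type} [∀ i, Field (Kf i)] [∀ i, NumberField (Kf i)] [∀ i, IsCMField (Kf i)]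
  {i₀ i₁ i₂ : I} {N : ℕ} (κ : Fin N → Fin 3) {e₂ : (Kf i₁ →+* ℂ) ≃ Fin 4 × Bool} {e₃ : (Kf i₂ →+* ℂ) ≃ Fin 5 × Bool}
  {τ : Kf i₀ →+* ℂ} (hττ : ComplexEmbedding.conjugate τ ≠ τ) (hk : ∀ σ : Kf i₀ →+* ℂ, σ = τ ∨ σ = ComplexEmbedding.conjugate τ)
  (he₂_conj : ∀ s : Kf i₁ →+* ℂ, e₂ (ComplexEmbedding.conjugate s) = ((e₂ s).1, !(e₂ s).2))
  (he₃_conj : ∀ t : Kf i₂ →+* ℂ, e₃ (ComplexEmbedding.conjugate t) = ((e₃ t).1, !(e₃ t).2))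
  {A : Fin 3 → AbelianVariety ℂ} {Φ : ∀ j : Fin 3, CMType (Kf (soSlots i₀ i₁ i₂ j))}
  {ι : ∀ j, 𝓞 (Kf (soSlots i₀ i₁ i₂ j)) →+* End (A j)}
  {θ : ∀ j, Kf (soSlots i₀ i₁ i₂ j) →+* Module.End ℂ (complexBetti (A j).X 1)}
  (hA : ∀ j, IsCMTypeRealisation (Φ j) (A j) (ι j) (θ j))

include hττ hk he₂_conj he₃_conj hA in
/-- **A weight of `Y = ⨁ A` whose model image is a conjugate pair `{y, cjOD y}` is conjugation-stable, so its line is algebraic** (a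
divisor line: Lefschetz `(1,1)` on the abelian variety `⨁ A`). [cite: Gordon1999HodgeAVSurvey, 9.2.2] -/
theorem weightClassesAlg_le_algebraicClasses_of_image_eq_pairOD
    {T : Finset ((j : Fin 3) × (Kf (soSlots i₀ i₁ i₂ j) →+* ℂ))} {y : PtOD} (hT : T.image (toPtOD e₂ e₃ τ) = {y, cjOD y}) :
    T.card = 2 ∧ weightClassesAlg A ι (2 * 1) T ≤ algebraicClasses (⨁ A).X 1 := by
  have hinj := toPtOD_injective (e₂ := e₂) (e₃ := e₃) hττ hk (i₁ := i₁) (i₂ := i₂)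
  have hcard : T.card = 2 := by
    rw [← Finset.card_image_of_injective T hinj, hT]
    exact Finset.card_pair (cjOD_ne y).symm
  refine ⟨hcard, weightClassesAlg_le_algebraicClasses_of_conj_smul_mem hA (m := 1) hcard fun x hx => ?_⟩
  have hx' : toPtOD e₂ e₃ τ x ∈ ({y, cjOD y} : Finset PtOD) := hT ▸ Finset.mem_image_of_mem _ hx
  have hcx : toPtOD e₂ e₃ τ ((starRingAut : ℂ ≃+* ℂ) • x) ∈ T.image (toPtOD e₂ e₃ τ) := by
    rw [toPtOD_conj_smul hττ hk he₂_conj he₃_conj x, hT, Finset.mem_insert, Finset.mem_singleton] at *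
    rcases hx' with h | h
    · exact Or.inr (by rw [h])
    · exact Or.inl (by rw [h, cjOD_cjOD])
  exact (hinj.mem_finset_image).1 hcx

include hττ hk he₂_conj he₃_conj hA in
/-- **A pair part of a weight of `X = ⨁_j A(κ j)` has an algebraic (divisor) line**: the model map is injective on it with image a
conjugate pair, so its slot projection to `Y = ⨁ A` is a weight with the same image — a divisor line — lifted along `κ` (distribution
lemma). [cite: Gordon1999HodgeAVSurvey, 9.2.2] [cite: Milne2020HodgeClassesAV, 1.2 (a) and Thm. 1] -/
theorem weightClassesAlg_le_algebraicClasses_of_isPairPartOD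
    {G : Finset ((j : Fin N) × (Kf (soSlots i₀ i₁ i₂ (κ j)) →+* ℂ))}
    (hG : IsPairPartOD (fun x => toPtOD e₂ e₃ τ ((Sigma.map κ (fun _ => id) :
      ((j : Fin N) × (Kf (soSlots i₀ i₁ i₂ (κ j)) →+* ℂ)) → ((m : Fin 3) × (Kf (soSlots i₀ i₁ i₂ m) →+* ℂ))) x)) G) :
    G.card = 2 * 1 ∧ weightClassesAlg (fun j => A (κ j)) (fun j => ι (κ j)) (2 * 1) G ≤
      algebraicClasses (⨁ fun j => A (κ j)).X 1 := by
  obtain ⟨y, hcard, hinj, himg⟩ := hG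
  set Pm : ((j : Fin N) × (Kf (soSlots i₀ i₁ i₂ (κ j)) →+* ℂ)) → ((m : Fin 3) × (Kf (soSlots i₀ i₁ i₂ m) →+* ℂ)) :=
    Sigma.map κ (fun _ => id) with hPm
  have hPinj : Set.InjOn Pm ↑G := fun x hx x' hx' h => hinj hx hx' (by change toPtOD e₂ e₃ τ (Pm x) = toPtOD e₂ e₃ τ (Pm x'); rw [h])
  set TY : Finset ((m : Fin 3) × (Kf (soSlots i₀ i₁ i₂ m) →+* ℂ)) := G.image Pm with hTY
  have hTYimg : TY.image (toPtOD e₂ e₃ τ) = {y, cjOD y} := by rw [hTY, Finset.image_image]; exact himg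
  obtain ⟨-, hYalg⟩ := weightClassesAlg_le_algebraicClasses_of_image_eq_pairOD hττ hk he₂_conj he₃_conj hA hTYimg
  have hq : G.card = 2 * 1 := by rw [hcard]
  exact ⟨hq, weightClassesAlg_comp_le_algebraicClasses_of_injOn (K := fun m => Kf (soSlots i₀ i₁ i₂ m)) hA κ hq hPinj hYalg⟩

end Pairs

end Summit.HodgeConjecture.CorCM.OcticDecicWeil

end
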